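import Summits.BirchSwinnertonDyer.BirchSwinnertonDyer.Theorems.SylvesterTwoHeegnerIndexCMHalfPrep
import Summits.BirchSwinnertonDyer.BirchSwinnertonDyer.Theorems.SylvesterTwoHeegnerIndexCMFlipCoherentFrame
import HarnessLib

/-!
# (S3) of leaf (L1) at `p ≡ 7 (mod 9)`, crux `UpperOffV0HSYPlus` (stmt-BirchSwinnertonDyer-19804): THE HALF
# TRANSVERSAL — the product representatives over `(𝒢₀⧸H) × H′` represent `Γ_K / N″`, `N″` the fixer of the fixed
# field of the involution `s`

Skeleton of record VARIANT M (`Cruxes/UpperOffV0HSYPlus/Lines/coupled_variantM.lean` 406ca288e244d392), stub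
`stub_layerL1Seven`; planner D507 (4), D510 (GO; label of record: leaf (L1)@7 = g24's architecture re-instantiated
on the HALF index set + ONE displayed cell lemma, TOWER FIXING (memo two §67.2 (W2-b))).  The halved `χ`-sums run
over `(𝒢₀⧸H) × H′` (`𝒢₀ = Gal(K[9p]/K)`, `H` the stabiliser of `∛3, ∛p`, `H = H′ ⊔ H′s`); k-ty1's invariance law
`JZero.cubicTwist_chiComponent_fixedPoints_mem_invPoints` wants representatives BIJECTIVE onto `Γ_K ⧸ N′` for a
subgroup `N′` — here `N″ := Gal(K̄ / emb K[9p]^{⟨s⟩})`, the fixer of the fixed field of `s`.  This file is input-free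
(pure Galois bookkeeping; the involution is a binder, no fixing of CM points is used):

* §1 `eq_one_or_eq_of_mem_zpowers` (`⟨s⟩ = {1, s}` for `s² = 1`), `bijective_quotient_zpowers_half` — at the finite
  level, `(q, h′) ↦ q̃ h′` is a bijection `(𝒢₀⧸H) × H′ ≃ 𝒢₀ ⧸ ⟨s⟩`.
* §2 `exists_halfFixer` — the subgroup `N″ ≤ Γ_K` fixing `emb (K[9p]^{⟨s⟩})`, with: `N₀ ≤ N″`; every `g ∈ N″` acts
  on `emb K[9p]` as `1` or as `s` (dichotomy); `N″` fixes the cube roots `v_B` (of `p/9`) and `v_A` (of `p²/3`);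
  and the product representatives `t (q, h′) = T(q̃)·T(h′)` over `(𝒢₀⧸H) × H′` are BIJECTIVE onto `Γ_K ⧸ N″`
  (`bijective_quotient_of_finite_level`).

Theorems only (no `def`, no `sorry`, no new `Prop`); nothing asserted on 19804; no stub closed; X12.CMAtTwo NOT
proved; BSD is not proved by any of this.  `--supports stmt-BirchSwinnertonDyer-19804 --as helper`.
-/

set_option linter.dupNamespace false
set_option autoImplicit false

noncomputable section

open scoped Classical Pointwise

namespace Summit.BirchSwinnertonDyer.BirchSwinnertonDyer.Theorems.SylvesterTwoCMHalf

open WeierstrassCurve WeierstrassCurve.Affine.Point Field NumberField IsDedekindDomain Finset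
open Literature.NumberTheory.EllipticCurves Literature.NumberTheory.GaloisRepresentations
  Literature.NumberTheory.EllipticCurves.ModularForms
  Literature.NumberTheory.EllipticCurves.HuShuYin2019
  Literature.NumberTheory.EllipticCurves.KolyvaginCocycle
  Summit.BirchSwinnertonDyer.BirchSwinnertonDyer.Theorems.SylvesterTwoCMData
  Summit.BirchSwinnertonDyer.BirchSwinnertonDyer.Theorems.SylvesterTwoCMFlip

variable {K : Type} [Field K] [NumberField K]

/-! ## §1. The finite level: `(𝒢₀⧸H) × H′ ≃ 𝒢₀ ⧸ ⟨s⟩` -/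

/-- `⟨s⟩ = {1, s}` for an element with `s * s = 1`. [folklore] -/
theorem eq_one_or_eq_of_mem_zpowers {G : Type*} [Group G] {s g : G} (hs2 : s * s = 1)
    (hg : g ∈ Subgroup.zpowers s) : g = 1 ∨ g = s := by
  by_cases hs1 : s = 1
  · subst hs1
    rw [Subgroup.zpowers_one_eq_bot, Subgroup.mem_bot] at hg
    exact Or.inl hg
  have hord : orderOf s = 2 := by
    haveI : Fact (Nat.Prime 2) := ⟨Nat.prime_two⟩
    exact orderOf_eq_prime (by rw [pow_two, hs2]) hs1
  obtain ⟨k, rfl⟩ := Subgroup.mem_zpowers_iff.mp hg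
  rw [← zpow_mod_orderOf, hord]
  rcases Int.emod_two_eq_zero_or_one k with h0 | h1
  · left; rw [show ((2 : ℕ) : ℤ) = 2 from rfl, h0, zpow_zero]
  · right; rw [show ((2 : ℕ) : ℤ) = 2 from rfl, h1, zpow_one]

/-- **The half index set represents `𝒢₀ ⧸ ⟨s⟩`**: for a subgroup `H ≤ G`, `s ∈ H` with `s * s = 1` and a half
`H′` of `H` (`∀ h, Xor (h ∈ H′) (h s ∈ H′)`), `(q, h′) ↦ q̃ · h′` is a bijection `(G⧸H) × H′ ≃ G ⧸ ⟨s⟩`.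
[folklore] -/
theorem bijective_quotient_zpowers_half {G : Type*} [Group G] (H : Subgroup G) (s : H)
    (hs2 : s * s = 1) (H' : Finset H) (hH' : ∀ h : H, Xor (h ∈ H') (h * s ∈ H')) :
    Function.Bijective fun i : (G ⧸ H) × H' ↦
      (Quotient.out i.1 * ((i.2 : H) : G) : G ⧸ Subgroup.zpowers ((s : H) : G)) := by
  have hs2' : ((s : H) : G) * ((s : H) : G) = 1 := by rw [← Subgroup.coe_mul, hs2, Subgroup.coe_one]
  constructor
  · rintro ⟨q₁, h₁⟩ ⟨q₂, h₂⟩ e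
    dsimp only at e
    -- `(q̃₁ h₁)⁻¹ (q̃₂ h₂) = x ∈ {1, s}`, so `q̃₂ h₂ = q̃₁ h₁ x` with `x ∈ H`
    obtain ⟨x, hxdef⟩ : ∃ x : G, (Quotient.out q₁ * ((h₁ : H) : G))⁻¹ * (Quotient.out q₂ * ((h₂ : H) : G)) = x :=
      ⟨_, rfl⟩
    have hxmem : x ∈ Subgroup.zpowers ((s : H) : G) := hxdef ▸ QuotientGroup.eq.mp e
    have hxH : x ∈ H := by
      rcases eq_one_or_eq_of_mem_zpowers hs2' hxmem with h1 | hs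
      · rw [h1]; exact H.one_mem
      · rw [hs]; exact s.2
    have hb : Quotient.out q₂ * ((h₂ : H) : G) = Quotient.out q₁ * ((h₁ : H) : G) * x := by
      rw [← hxdef, mul_inv_cancel_left]
    have hq : q₁ = q₂ := by
      rw [← QuotientGroup.out_eq' q₁, ← QuotientGroup.out_eq' q₂]
      refine QuotientGroup.eq.mpr ?_
      have : (Quotient.out q₁)⁻¹ * Quotient.out q₂ = ((h₁ : H) : G) * x * ((h₂ : H) : G)⁻¹ := by
        rw [eq_mul_inv_iff_mul_eq, mul_assoc, hb]; group
      rw [this]; exact H.mul_mem (H.mul_mem (h₁ : H).2 hxH) (H.inv_mem (h₂ : H).2)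
    subst hq
    have hh : ((h₂ : H) : G) = ((h₁ : H) : G) * x := by
      rw [mul_assoc] at hb; exact mul_left_cancel hb
    rcases eq_one_or_eq_of_mem_zpowers hs2' hxmem with h1 | hs
    · rw [h1, mul_one] at hh
      rw [Subtype.ext (Subtype.ext hh.symm)]
    · exfalso
      rw [hs, ← Subgroup.coe_mul] at hh
      have e2 : (h₂ : H) = (h₁ : H) * s := Subtype.ext hh
      rcases hH' (h₁ : H) with ⟨-, hn⟩ | ⟨-, hn⟩
      · exact hn (e2 ▸ h₂.2)
      · exact hn h₁.2
  · intro c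
    obtain ⟨g, rfl⟩ := QuotientGroup.mk_surjective c
    set q : G ⧸ H := QuotientGroup.mk g with hq
    have hmemH : (Quotient.out q)⁻¹ * g ∈ H := QuotientGroup.eq.mp (by rw [hq, QuotientGroup.out_eq'])
    set h : H := ⟨_, hmemH⟩ with hh
    rcases hH' h with ⟨hin, -⟩ | ⟨hin, -⟩
    · refine ⟨(q, ⟨h, hin⟩), ?_⟩
      dsimp only
      rw [hh]; simp only [mul_inv_cancel_left]
    · refine ⟨(q, ⟨h * s, hin⟩), ?_⟩
      dsimp only
      rw [QuotientGroup.eq, hh, Subgroup.coe_mul]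
      simp only [mul_inv_rev, mul_assoc, inv_mul_cancel, mul_one]
      exact (Subgroup.zpowers _).inv_mem (Subgroup.mem_zpowers _)

/-! ## §2. The half fixer `N″ = Gal(K̄ / emb K[9p]^{⟨s⟩})` and the half transversal of `Γ_K / N″` -/

/-- **THE HALF TRANSVERSAL.**  Bottom level `K[9p]` embedded by `emb` (fixer `N₀`), `∛3, ∛p ∈ K[9p]` with stabiliser
`H ≤ 𝒢₀ = Gal(K[9p]/K)`, lifts `T σ ∈ Γ_K` and product representatives `t (q, h) = T(q̃)·T(h)`; an element `s ∈ H`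
with `s² = 1` and a half `H′` of `H`.  Then for `N″ :=` the subgroup of `Γ_K` fixing `emb (K[9p]^{⟨s⟩})`:
`N₀ ≤ N″`; every `g ∈ N″` acts on `emb K[9p]` as `1` or as `s`, and every lift of `s` lies in `N″`; `N″` fixes the
cube roots `v_B` of `p/9` and `v_A` of `p²/3`; and `(q, h′) ↦ t (q, h′)` is a BIJECTION `(𝒢₀⧸H) × H′ ≃ Γ_K ⧸ N″`
(Galois correspondence `Fix(K[9p]^{⟨s⟩}) = ⟨s⟩` + `bijective_quotient_of_finite_level`).
[cite: GrossLMS1991, §3 (3.3)–(3.4), §4 (4.1)–(4.2)] [cite: HuShuYin2019, §2 Prop. 2.4 (1)] -/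
theorem exists_halfFixer {ω : K} (hω : ω ^ 2 + ω + 1 = 0) (h2 : Module.finrank ℚ K = 2) (ι : K →+* ℂ)
    {p : ℕ} (hp0 : p ≠ 0)
    {vB vA : AlgebraicClosure K} (hvBc : vB ^ 3 = algebraMap ℚ (AlgebraicClosure K) ((p : ℚ) / 9))
    (hvAc : vA ^ 3 = algebraMap ℚ (AlgebraicClosure K) ((p : ℚ) ^ 2 / 3))
    (emb : ringClassField K ι (9 * p) →+* AlgebraicClosure K)
    (hemb : ∀ k : K, emb (algebraMap K (ringClassField K ι (9 * p)) k) = algebraMap K (AlgebraicClosure K) k)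
    (N₀ : Subgroup (absoluteGaloisGroup K))
    (hN₀ : ∀ g : absoluteGaloisGroup K, g ∈ N₀ ↔
      ∀ x : ringClassField K ι (9 * p), (show AlgebraicClosure K ≃ₐ[K] AlgebraicClosure K from g) (emb x) = emb x)
    {c₃ cp : ringClassField K ι (9 * p)} (hc₃ : c₃ ^ 3 = 3) (hcp : cp ^ 3 = (p : ringClassField K ι (9 * p)))
    (H : Subgroup (ringClassField K ι (9 * p) ≃ₐ[K] ringClassField K ι (9 * p)))
    (hH : ∀ σ, σ ∈ H ↔ σ c₃ = c₃ ∧ σ cp = cp)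
    (T : (ringClassField K ι (9 * p) ≃ₐ[K] ringClassField K ι (9 * p)) → absoluteGaloisGroup K)
    (hT : ∀ σ (x : ringClassField K ι (9 * p)),
      (show AlgebraicClosure K ≃ₐ[K] AlgebraicClosure K from T σ) (emb x) = emb (σ x))
    (t : ((ringClassField K ι (9 * p) ≃ₐ[K] ringClassField K ι (9 * p)) ⧸ H) × H → absoluteGaloisGroup K)
    (ht' : ∀ q h, t (q, h) = T (Quotient.out q) * T (h : _))
    (s : H) (hs2 : s * s = 1) (H' : Finset H) (hH' : ∀ h : H, Xor (h ∈ H') (h * s ∈ H')) :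
    ∃ N'' : Subgroup (absoluteGaloisGroup K),
      (∀ g ∈ N₀, g ∈ N'') ∧
      (∀ g ∈ N'', (∀ x : ringClassField K ι (9 * p),
          (show AlgebraicClosure K ≃ₐ[K] AlgebraicClosure K from g) (emb x) = emb x) ∨
        (∀ x : ringClassField K ι (9 * p),
          (show AlgebraicClosure K ≃ₐ[K] AlgebraicClosure K from g) (emb x) =
            emb ((s : ringClassField K ι (9 * p) ≃ₐ[K] ringClassField K ι (9 * p)) x))) ∧
      (∀ g : absoluteGaloisGroup K, (∀ x : ringClassField K ι (9 * p),
          (show AlgebraicClosure K ≃ₐ[K] AlgebraicClosure K from g) (emb x) =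
            emb ((s : ringClassField K ι (9 * p) ≃ₐ[K] ringClassField K ι (9 * p)) x)) → g ∈ N'') ∧
      (∀ g ∈ N'', (show AlgebraicClosure K ≃ₐ[K] AlgebraicClosure K from g) vB = vB) ∧
      (∀ g ∈ N'', (show AlgebraicClosure K ≃ₐ[K] AlgebraicClosure K from g) vA = vA) ∧
      Function.Bijective fun i : ((ringClassField K ι (9 * p) ≃ₐ[K] ringClassField K ι (9 * p)) ⧸ H) × H' ↦
        (t (i.1, (i.2 : H)) : absoluteGaloisGroup K ⧸ N'') := by
  have hK := JZero.isImaginaryQuadratic_of_sq_add_self_add_one hω h2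
  have hm0 : 9 * p ≠ 0 := mul_ne_zero (by norm_num) hp0
  haveI := (finiteDimensional_and_isGalois_ringClassField hK ι hm0).1
  haveI := (finiteDimensional_and_isGalois_ringClassField hK ι hm0).2
  -- the fixed field of `⟨s⟩` and its fixer in `Γ_K`
  set sG : ringClassField K ι (9 * p) ≃ₐ[K] ringClassField K ι (9 * p) :=
    ((s : H) : ringClassField K ι (9 * p) ≃ₐ[K] ringClassField K ι (9 * p)) with hsG
  set F : IntermediateField K (ringClassField K ι (9 * p)) := IntermediateField.fixedField (Subgroup.zpowers sG)
    with hF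
  obtain ⟨N'', hN''⟩ := exists_subgroup_mem_iff_forall emb (F : Set (ringClassField K ι (9 * p)))
  have hsG2 : sG * sG = 1 := by rw [hsG, ← Subgroup.coe_mul, hs2, Subgroup.coe_one]
  -- Galois correspondence: `σ ∈ ⟨s⟩ ↔ σ` fixes `F` pointwise
  have hH₀ : ∀ σ : ringClassField K ι (9 * p) ≃ₐ[K] ringClassField K ι (9 * p),
      σ ∈ Subgroup.zpowers sG ↔ ∀ x ∈ (F : Set (ringClassField K ι (9 * p))), σ x = x := by
    intro σ
    constructor
    · intro hσ x hx
      exact (IntermediateField.mem_fixedField_iff _ x).mp hx σ hσ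
    · intro hσ
      rw [← IntermediateField.fixingSubgroup_fixedField (Subgroup.zpowers sG), IntermediateField.mem_fixingSubgroup_iff]
      exact fun x hx ↦ hσ x hx
  -- the dichotomy
  have hdich : ∀ g ∈ N'', (∀ x : ringClassField K ι (9 * p),
        (show AlgebraicClosure K ≃ₐ[K] AlgebraicClosure K from g) (emb x) = emb x) ∨
      (∀ x : ringClassField K ι (9 * p),
        (show AlgebraicClosure K ≃ₐ[K] AlgebraicClosure K from g) (emb x) = emb (sG x)) := by
    intro g hg
    obtain ⟨σ, hσ⟩ := exists_algEquiv_comp_eq emb hemb g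
    have hσS : σ ∈ Subgroup.zpowers sG := by
      refine (hH₀ σ).mpr fun x hx ↦ emb.injective ?_
      rw [← hσ x]; exact (hN'' g).mp hg x hx
    rcases eq_one_or_eq_of_mem_zpowers hsG2 hσS with h1 | hs
    · left; intro x; rw [hσ x, h1]; rfl
    · right; intro x; rw [hσ x, hs]
  have hlift : ∀ g : absoluteGaloisGroup K, (∀ x : ringClassField K ι (9 * p),
      (show AlgebraicClosure K ≃ₐ[K] AlgebraicClosure K from g) (emb x) = emb (sG x)) → g ∈ N'' := by
    intro g hg
    refine (hN'' g).mpr fun x hx ↦ ?_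
    rw [hg x, (IntermediateField.mem_fixedField_iff _ x).mp hx sG (Subgroup.mem_zpowers _)]
  have hle : ∀ g ∈ N₀, g ∈ N'' := fun g hg ↦ (hN'' g).mpr fun x _ ↦ (hN₀ g).mp hg x
  -- `N″` fixes `emb ∛3`, `emb ∛p`, hence `v_B`, `v_A`
  have hc₃0 : c₃ ≠ 0 := fun h ↦ by rw [h] at hc₃; norm_num at hc₃
  have hcp0 : cp ≠ 0 := fun h ↦ by
    rw [h, zero_pow three_ne_zero] at hcp; exact hp0 (by exact_mod_cast hcp.symm)
  have hfix3p : ∀ g ∈ N'', (show AlgebraicClosure K ≃ₐ[K] AlgebraicClosure K from g) (emb c₃) = emb c₃ ∧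
      (show AlgebraicClosure K ≃ₐ[K] AlgebraicClosure K from g) (emb cp) = emb cp := by
    intro g hg
    rcases hdich g hg with h1 | hs
    · exact ⟨h1 c₃, h1 cp⟩
    · exact ⟨by rw [hs, ((hH _).mp s.2).1], by rw [hs, ((hH _).mp s.2).2]⟩
  have hwB3 : (emb cp / emb c₃ ^ 2) ^ 3 = vB ^ 3 := by
    rw [hvBc, div_pow, ← pow_mul, ← map_pow, ← map_pow, hcp, show 2 * 3 = 3 * 2 from rfl, pow_mul, hc₃,
      map_natCast, map_pow, map_ofNat, eq_ratCast]
    push_cast; ring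
  have hwB0 : emb cp / emb c₃ ^ 2 ≠ 0 :=
    div_ne_zero ((map_ne_zero emb).mpr hcp0) (pow_ne_zero 2 ((map_ne_zero emb).mpr hc₃0))
  have hwA3 : (emb cp ^ 2 / emb c₃) ^ 3 = vA ^ 3 := by
    rw [hvAc, div_pow, ← pow_mul, ← map_pow, ← map_pow, show 2 * 3 = 3 * 2 from rfl, pow_mul, hcp,
      hc₃, map_pow, map_natCast, map_ofNat, eq_ratCast]
    push_cast; ring
  have hwA0 : emb cp ^ 2 / emb c₃ ≠ 0 :=
    div_ne_zero (pow_ne_zero 2 ((map_ne_zero emb).mpr hcp0)) ((map_ne_zero emb).mpr hc₃0)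
  have hNvB : ∀ g ∈ N'', (show AlgebraicClosure K ≃ₐ[K] AlgebraicClosure K from g) vB = vB := fun g hg ↦
    JZero.apply_eq_self_of_cubeRoot hω _ hwB0 hwB3.symm
      (by rw [map_div₀, map_pow, (hfix3p g hg).1, (hfix3p g hg).2])
  have hNvA : ∀ g ∈ N'', (show AlgebraicClosure K ≃ₐ[K] AlgebraicClosure K from g) vA = vA := fun g hg ↦
    JZero.apply_eq_self_of_cubeRoot hω _ hwA0 hwA3.symm
      (by rw [map_div₀, map_pow, (hfix3p g hg).1, (hfix3p g hg).2])
  refine ⟨N'', hle, hdich, hlift, hNvB, hNvA, ?_⟩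
  -- the bijection, lifted from the finite level
  refine bijective_quotient_of_finite_level emb hemb (F : Set (ringClassField K ι (9 * p))) N'' hN''
    (Subgroup.zpowers sG) hH₀ (fun i ↦ Quotient.out i.1 * ((i.2 : H) : _))
    (bijective_quotient_zpowers_half H s hs2 H' hH') _ fun i x ↦ ?_
  obtain ⟨q, h⟩ := i
  change (show AlgebraicClosure K ≃ₐ[K] AlgebraicClosure K from t (q, (h : H))) (emb x) = _
  rw [ht', AlgEquiv.mul_apply]
  change (show AlgebraicClosure K ≃ₐ[K] AlgebraicClosure K from T (Quotient.out q))
    ((show AlgebraicClosure K ≃ₐ[K] AlgebraicClosure K from T ((h : H) : _)) (emb x)) = _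
  rw [hT, hT]

end Summit.BirchSwinnertonDyer.BirchSwinnertonDyer.Theorems.SylvesterTwoCMHalf

end
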